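/-
Copyright: statement-level skeleton of a published paper (lit-balaban cell, Phase-2 proof seat p13, gen 12). No proof
claims beyond what the kernel checks below.
-/
import Literature.MathematicalPhysics.QuantumFieldTheory.BalabanImbrieJaffe1984to88.BIJ88PairingDisplay305

/-!
# `BalabanImbrieJaffe1984to88.BIJ88SecondOrder5133` — T. Bałaban, J. Imbrie, A. Jaffe, *Effective action and cluster
properties of the abelian Higgs model*, Commun. Math. Phys. **114** (1988) 257–315 [BalabanImbrieJaffe1988], §5.13
p. 305 [PDF 49]: **the second `s`-derivative of the interpolated expectation, CORRECTLY EVALUATED** — the order-`|Γ| = 2`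
case of *"Subsequent derivatives either hit factors s_j already pulled down or bring new terms down with new
truncations"*, keeping BOTH alternatives:

  `∂²/∂s_j∂s_i ⟨H⟩_s = −⟨[B_{ij};] H⟩_s + κ₃(D_i, D_j, H)_s`   (`i ≠ j`, tree sign `Δ = −Δ_print`),

`B_{ij} = ⟨□_iΦ, Δ□_jΦ⟩` (the vertex obtained when `∂/∂s_j` *hits the factor s_j already pulled down* in
`D_i = Σ_{l≠i} s_l⟨□_iΦ,Δ□_lΦ⟩`), `κ₃` the third joint cumulant (the *new truncation* when `∂/∂s_j` hits the measure
again, bringing down `D_j` while `D_i` — with its factors `s_l`, `l ∈ Γ` — survives).  In print notation (vertex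
`V_{ij} = ⟨□_iΦ,Δ_print□_jΦ⟩ = −B_{ij}`, `D^print_i = −D_i`): `∂_j∂_i⟨H⟩_s = ⟨[V_{ij};]H⟩_s + ⟨[D^print_i;][D^print_j;]H⟩_s`;
at the evaluation point of the fundamental-theorem-of-calculus formula for `Γ = {i,j}` (`s_l = 0` off `Γ`) the second
term is `s_is_j⟨[V_{ij};][V_{ji};]H⟩_s` — the term the p. 305 pairing display omits (`BIJ88PairingDisplay305`, kernel
witness `pairingDisplay_fails`, GAPS.md G-C2-24).  This file supplies the corrected identity in the general
finite-dimensional Gaussian model of record (p13 g6 / p02 / p25), for bounded measurable observables `H`.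

READING OF (5.13.3) PROPER (p. 306), asked by the row owner (r16, 2026-08-22T04:17:58Z): (5.13.3) INHERITS the omission,
it cannot be read as already containing the omitted trains.  (i) Its walks come from *"The sum over pairings and the sum
over ways of arranging the contractions combine into a sum over walks"* — i.e. from the pairing display —, each site of a
block `α ∈ π` is consumed by exactly one vertex `□_{i_{2m−1}}Δ□_{i_{2m}}` of `C_ω = C_s□_{i₁}Δ□_{i₂}C_s□_{i₃}…□_{i_{|ω|}}C_s`,
and no factor `s` appears in (5.13.3) or in `C_ω`.  (ii) After integration by parts the omitted terms are trains
containing vertices `s_l·□_iΔ□_l` in which the cube `i` is consumed (its `∂/∂s_i` produced the vertex `D_i`) while the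
cube `l ∈ Γ` is only REVISITED (weight `s_l`; `l` is consumed by another vertex, possibly in ANOTHER train of the same
term), so a corrected (5.13.3) needs walks that may revisit cubes of `Γ` across the blocks of `π`, with weights `s_l`
on the revisiting legs; reading the printed `Δ` as `Δ_s` does not repair it (that puts `s_as_b` on every vertex, wrong
for a consumed pair `{a,b}`, whose weight is `∂_a∂_b(s_as_b) = 1`).  The corrected evaluation at every order is the
cumulant expansion `∂_Γ⟨H⟩_s = Σ_{σ ∈ set partitions of Γ, blocks of size ≤ 2} ⟨Π_{B∈σ}[V_B;] H⟩_s`,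
`V_{{i,j}} = ⟨□_iΦ,Δ_print□_jΦ⟩`, `V_{{i}} = Σ_{l∈Γ∖i} s_l⟨□_iΦ,Δ_print□_lΦ⟩` (joint cumulants), of which this file
proves the case `|Γ| = 2`.

statement-level skeleton of published theorems with citation tags; proofs where landed; nothing here is a claim
about the Yang–Mills mass gap

PDF held: `paper:balaban1988-cmp114-bij-abelian-higgs-effective-action` (journal page = PDF page + 256; p. 305 re-read as
the image `lit-balaban-ref-1/renders/cmp114/original-p049-x2.png`).

CITATION HEADER (lean-in-tree rule).  lit-balaban cell (HOME `run/shared/lean/pub/lit-balaban/`), Phase 2, seat p13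
gen 12; row **C2.Eq5.13.3-5.13.4** of `HOME/lit-balaban-r16/ROWS-C2-part2.md` (owner r16, referee ref-5).  USED BY NAME,
nothing restated: p13 g6 `BIJ88SDerivative305.hasDerivAt_integral_interp` (first derivative under the integral, bounded
observables), `abs_D_le`, `update_mem_cube`, `integral_weight_mul_source_pos`; p13 g6
`BIJ88IntegrationByParts305.integrable_bdd_mul_weight_source`, `continuous_gauss`, `isSymm_of_posDef`; p02
`BIJ88DirichletForms305.interpForm(_apply)`, `boxProj_mulVec_apply`, `BIJ88DirichletDeriv305.blockPair`; p13 g12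
`BIJ88PairingDisplay305.expect`.

## What is proved (0 `sorry`, standard axioms, no new `Prop` facts)

* §1 SHIFTING THE PRECISION (the device that extends the bounded-observable calculus of p13 g6 to observables of
  Gaussian growth `‖G Φ‖ ≤ K e^{ε‖Φ‖²}`): `interpForm_sub_smul_one` (`(Δ − ε1)_s = Δ_s − ε1`), `quadForm_sub_smul_one`,
  `weight_sub_smul_one` (`e^{−½⟨Φ,(A−ε1)Φ⟩} = e^{−½⟨Φ,AΦ⟩}e^{(ε/2)‖Φ‖²}`), `boxProj_dot_boxProj` (`⟨□_iΦ,□_jΦ⟩ = 0`, `i ≠ j`),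
  `blockPair_sub_smul_one` (`B_{ij}` unchanged, `i ≠ j`), `D_sub_smul_one`, `formBounds_shift`, `posDef_of_formBound`.
* §2 **`integrable_growth_of_lower`**/**`integrable_growth`** (observables with `‖G Φ‖ ≤ K₀e^{ε‖Φ‖²}` are integrable
  against `e^{−½⟨Φ,AΦ⟩}e^{⟨ℱ,Φ⟩}` when `⟨Φ,AΦ⟩ ≥ c′‖Φ‖²`, `2ε < c′`), **`hasDerivAt_integral_interp_growth`**: p13 g6
  `hasDerivAt_integral_interp` for such observables (`2ε < c`, `c` the lower form bound of `Δ`):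
  `d/dt ∫G dμ_{s[i↦t]} = −∫D_iG dμ`, by transport along `Δ ↦ Δ − 2ε1`.
* §3 the quadratic insertions have Gaussian growth: `abs_blockPair_le` (`|B_{ij}| ≤ (|C−c|/2)‖Φ‖²`), private `le_exp_div`,
  `growth_of_quad_mul_bdd`; `D_update_eq` (`D_i(s[j↦u]) = u·B_{ij} + D_i(s[j↦0])`, the affine dependence behind *"hit
  factors s_j already pulled down"*); `continuous_blockPair`, `continuous_D`.
* §4 `num` (`N_G(s′) = ∫G dμ_{s′}`), `Dfun` (`D_i(s′,Φ)`); **`hasDerivAt_dnum`** — THE NUMERATOR AT SECOND ORDER: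
  `∂/∂s_j|_s (−∫ D_i(s[j↦u]) H dμ_{s[j↦u]}) = ∫ (D_iD_j − B_{ij}) H dμ_s` (`i ≠ j`).
* §5 **`hasDerivAt_dexpect`** — THE NORMALIZED EXPECTATION AT SECOND ORDER:
  `∂/∂s_j [−(⟨D_iH⟩_s − ⟨D_i⟩_s⟨H⟩_s)] = −⟨[B_{ij};]H⟩_s + κ₃(D_i,D_j,H)_s` with
  `⟨[X;]H⟩ = ⟨XH⟩ − ⟨X⟩⟨H⟩` and `κ₃(X,Y,H) = ⟨XYH⟩ − ⟨X⟩⟨YH⟩ − ⟨Y⟩⟨XH⟩ − ⟨XY⟩⟨H⟩ + 2⟨X⟩⟨Y⟩⟨H⟩`; the function being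
  differentiated IS `∂/∂s_i⟨H⟩` by p13 g6 `hasDerivAt_expectation_interp` (recalled as `hasDerivAt_expect`).
HONEST SCOPE.  Real fields, finite dimension, `H` bounded measurable (the `f(□_i)` and smooth cutoffs; polynomial
insertions enter only through `D_i`, `B_{ij}`); one pair of parameters (`|Γ| = 2`) — the all-orders structure (sum over
set partitions of `Γ` into blocks of size ≤ 2, singleton blocks carrying `D_i` restricted to `Γ`) is NOT proved here;
nothing is claimed about the convergence estimates of §5.13–§5.14 for the omitted terms.  NOT summit progress; NOT
continuum; NOT Clay.  Imports `BIJ88PairingDisplay305` (for `expect`); modifies nothing.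
-/

noncomputable section

namespace Literature.MathematicalPhysics.QuantumFieldTheory.BalabanImbrieJaffe1984to88.BIJ88SecondOrder5133

open MeasureTheory Matrix Finset Function Filter
open scoped BigOperators Topology
open Literature.MathematicalPhysics.QuantumFieldTheory.Balaban1983to89
open B2Eq228Conditioning (weight source)
open BIJ88DirichletForms305 (interpForm interpForm_apply interpForm_posDef boxProj boxProj_mulVec_apply)
open BIJ88DirichletDeriv305 (blockPair)
open BIJ88IntegrationByParts305 (integrable_bdd_mul_weight_source continuous_gauss isSymm_of_posDef source_eq
  continuous_dotProduct_right)
open BIJ88SDerivative305 (hasDerivAt_integral_interp abs_D_le update_mem_cube integral_weight_mul_source_pos)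

variable {α I : Type} [Fintype α] [DecidableEq α] [Fintype I] [DecidableEq I] (blk : α → I)

/-! ## §1  Shifting the precision by a multiple of the identity -/

/-- `(Δ − ε1)_s = Δ_s − ε1`: the identity is block-diagonal, so the interpolation does not touch it.
[cite: BalabanImbrieJaffe1988, §5.13 p.305] -/
theorem interpForm_sub_smul_one (Δ : Matrix α α ℝ) (ε : ℝ) (s : I → ℝ) :
    interpForm blk (Δ - ε • (1 : Matrix α α ℝ)) s = interpForm blk Δ s - ε • (1 : Matrix α α ℝ) := by
  ext x y
  simp only [interpForm_apply, Matrix.sub_apply, Matrix.smul_apply, Matrix.one_apply, smul_eq_mul]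
  by_cases hxy : x = y
  · subst hxy
    simp
  · have h1 : (if x = y then (1:ℝ) else 0) = 0 := if_neg hxy
    simp only [h1, mul_zero, sub_zero]

/-- `⟨Φ,(A − ε1)Φ⟩ = ⟨Φ,AΦ⟩ − ε‖Φ‖²`. [cite: BalabanImbrieJaffe1988, §5.13 p.305] -/
theorem quadForm_sub_smul_one (A : Matrix α α ℝ) (ε : ℝ) (φ : α → ℝ) :
    φ ⬝ᵥ ((A - ε • (1 : Matrix α α ℝ)) *ᵥ φ) = φ ⬝ᵥ (A *ᵥ φ) - ε * (φ ⬝ᵥ φ) := by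
  rw [Matrix.sub_mulVec, dotProduct_sub, Matrix.smul_mulVec, Matrix.one_mulVec, dotProduct_smul, smul_eq_mul]

/-- **`e^{−½⟨Φ,(A−ε1)Φ⟩} = e^{−½⟨Φ,AΦ⟩}·e^{(ε/2)‖Φ‖²}`** — a Gaussian growth factor is absorbed by lowering the precision.
[cite: BalabanImbrieJaffe1988, §5.13 p.305] -/
theorem weight_sub_smul_one (A : Matrix α α ℝ) (ε : ℝ) (φ : α → ℝ) :
    weight (A - ε • (1 : Matrix α α ℝ)) φ = weight A φ * Real.exp (ε / 2 * (φ ⬝ᵥ φ)) := by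
  rw [B2Eq228Conditioning.weight, B2Eq228Conditioning.weight, quadForm_sub_smul_one, ← Real.exp_add]
  congr 1
  ring

omit [Fintype I] in
/-- Distinct regions have orthogonal projections: `⟨□_iΦ, □_jΦ⟩ = 0` for `i ≠ j`. [cite: BalabanImbrieJaffe1988, §5.13 p.305] -/
theorem boxProj_dot_boxProj {i j : I} (hij : i ≠ j) (φ : α → ℝ) :
    (boxProj blk i *ᵥ φ) ⬝ᵥ (boxProj blk j *ᵥ φ) = 0 := by
  refine Finset.sum_eq_zero fun x _ => ?_
  rw [boxProj_mulVec_apply, boxProj_mulVec_apply]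
  by_cases hx : blk x = i
  · rw [if_neg (fun h => hij (hx.symm.trans h)), mul_zero]
  · rw [if_neg hx, zero_mul]

omit [Fintype I] in
/-- The inter-region vertex is blind to the shift: `⟨□_iΦ,(Δ−ε1)□_jΦ⟩ = ⟨□_iΦ,Δ□_jΦ⟩` for `i ≠ j`.
[cite: BalabanImbrieJaffe1988, §5.13 p.305] -/
theorem blockPair_sub_smul_one (Δ : Matrix α α ℝ) (ε : ℝ) (φ : α → ℝ) {i j : I} (hij : i ≠ j) :
    blockPair blk (Δ - ε • (1 : Matrix α α ℝ)) φ i j = blockPair blk Δ φ i j := by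
  rw [blockPair, blockPair, Matrix.sub_mulVec, dotProduct_sub, Matrix.smul_mulVec, Matrix.one_mulVec,
    dotProduct_smul, boxProj_dot_boxProj blk hij, smul_zero, sub_zero]

/-- `D_i` is blind to the shift: `Σ_{j≠i} s_j⟨□_iΦ,(Δ−ε1)□_jΦ⟩ = Σ_{j≠i} s_j⟨□_iΦ,Δ□_jΦ⟩`. [cite: BalabanImbrieJaffe1988, §5.13 p.305] -/
theorem D_sub_smul_one (Δ : Matrix α α ℝ) (ε : ℝ) (s : I → ℝ) (i : I) (φ : α → ℝ) :
    ∑ j ∈ univ.erase i, s j * blockPair blk (Δ - ε • (1 : Matrix α α ℝ)) φ i j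
      = ∑ j ∈ univ.erase i, s j * blockPair blk Δ φ i j :=
  Finset.sum_congr rfl fun j hj => by rw [blockPair_sub_smul_one blk Δ ε φ (Finset.ne_of_mem_erase hj).symm]

/-- The shifted form keeps form bounds: `(c−ε)‖v‖² ≤ ⟨v,(Δ−ε1)v⟩ ≤ (C−ε)‖v‖²`. [cite: BalabanImbrieJaffe1988, §5.13 p.305] -/
theorem formBounds_shift {Δ : Matrix α α ℝ} {c C : ℝ} (hcΔ : ∀ v, c * (v ⬝ᵥ v) ≤ v ⬝ᵥ (Δ *ᵥ v))
    (hCΔ : ∀ v, v ⬝ᵥ (Δ *ᵥ v) ≤ C * (v ⬝ᵥ v)) (ε : ℝ) :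
    (∀ v, (c - ε) * (v ⬝ᵥ v) ≤ v ⬝ᵥ ((Δ - ε • (1 : Matrix α α ℝ)) *ᵥ v)) ∧
      ∀ v, v ⬝ᵥ ((Δ - ε • (1 : Matrix α α ℝ)) *ᵥ v) ≤ (C - ε) * (v ⬝ᵥ v) := by
  constructor
  · intro v
    rw [quadForm_sub_smul_one]
    nlinarith [hcΔ v]
  · intro v
    rw [quadForm_sub_smul_one]
    nlinarith [hCΔ v]

omit [DecidableEq α] in
/-- A symmetric matrix with a positive lower form bound is positive definite. [folklore] -/
private theorem posDef_of_formBound {M : Matrix α α ℝ} (hM : M.IsSymm) {c : ℝ} (hc : 0 < c)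
    (hcM : ∀ v, c * (v ⬝ᵥ v) ≤ v ⬝ᵥ (M *ᵥ v)) : M.PosDef := by
  refine Matrix.posDef_iff_dotProduct_mulVec.mpr ⟨?_, fun v hv => ?_⟩
  · rw [Matrix.IsHermitian, Matrix.conjTranspose_eq_transpose_of_trivial]
    exact hM
  · rw [star_trivial]
    have hvv : 0 < v ⬝ᵥ v := by
      obtain ⟨x, hx⟩ : ∃ x, v x ≠ 0 := by
        by_contra h
        push Not at h
        exact hv (funext h)
      exact lt_of_lt_of_le (mul_self_pos.2 hx) (Finset.single_le_sum (fun y _ => mul_self_nonneg (v y)) (mem_univ x))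
    exact lt_of_lt_of_le (mul_pos hc hvv) (hcM v)

/-! ## §2  The first derivative for observables of Gaussian growth -/

/-- An observable of Gaussian growth `‖G Φ‖ ≤ K₀e^{ε‖Φ‖²}` is integrable against `e^{−½⟨Φ,AΦ⟩}e^{⟨ℱ,Φ⟩}` as soon as
`⟨Φ,AΦ⟩ ≥ c′‖Φ‖²` with `2ε < c′` (domination by the Gaussian `e^{⟨ℱ,Φ⟩}e^{−½(c′−2ε)‖Φ‖²}`, p13 g6 `integrable_tilt`).
[cite: BalabanImbrieJaffe1988, §5.13 p.305] -/
theorem integrable_growth_of_lower {A : Matrix α α ℝ} {c' : ℝ} (hA : ∀ φ : α → ℝ, c' * (φ ⬝ᵥ φ) ≤ φ ⬝ᵥ (A *ᵥ φ))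
    (f : α → ℝ) {G : (α → ℝ) → ℝ} (hGm : AEStronglyMeasurable G volume) {K₀ ε : ℝ} (hε : 2 * ε < c')
    (hK : ∀ φ, ‖G φ‖ ≤ K₀ * Real.exp (ε * (φ ⬝ᵥ φ))) :
    Integrable fun φ : α → ℝ => G φ * (weight A φ * source f φ) := by
  have hA' : ((c' - 2 * ε) • (1 : Matrix α α ℝ)).PosDef := Matrix.PosDef.one.smul (by linarith)
  have href := (BIJ88IntegrationByParts305.integrable_tilt hA' f).const_mul K₀
  refine href.mono' (hGm.mul (((continuous_gauss A).mul ((continuous_dotProduct_right f).rexp.congr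
    fun φ => (source_eq f φ).symm)).aestronglyMeasurable)) (Eventually.of_forall fun φ => ?_)
  have hw0 : 0 ≤ weight A φ := (B2Eq228Conditioning.weight_pos A φ).le
  have hw : weight A φ * Real.exp (ε * (φ ⬝ᵥ φ))
      ≤ Real.exp (-(1/2 : ℝ) * (φ ⬝ᵥ ((c' - 2 * ε) • (1 : Matrix α α ℝ)) *ᵥ φ)) := by
    rw [B2Eq228Conditioning.weight, ← Real.exp_add, Real.exp_le_exp, Matrix.smul_mulVec, Matrix.one_mulVec,
      dotProduct_smul, smul_eq_mul]
    nlinarith [hA φ]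
  have hws : ‖weight A φ * source f φ‖ = weight A φ * Real.exp (φ ⬝ᵥ f) := by
    rw [Real.norm_of_nonneg (mul_nonneg hw0 (B2Eq228Conditioning.source_pos f φ).le), source_eq]
  rw [norm_mul, hws]
  calc ‖G φ‖ * (weight A φ * Real.exp (φ ⬝ᵥ f))
      ≤ K₀ * Real.exp (ε * (φ ⬝ᵥ φ)) * (weight A φ * Real.exp (φ ⬝ᵥ f)) :=
        mul_le_mul_of_nonneg_right (hK φ) (mul_nonneg hw0 (Real.exp_pos _).le)
    _ = K₀ * (Real.exp (φ ⬝ᵥ f) * (weight A φ * Real.exp (ε * (φ ⬝ᵥ φ)))) := by ring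
    _ ≤ K₀ * (Real.exp (φ ⬝ᵥ f) * Real.exp (-(1/2 : ℝ) * (φ ⬝ᵥ ((c' - 2 * ε) • (1 : Matrix α α ℝ)) *ᵥ φ))) := by
        have hK0' : 0 ≤ K₀ := by
          have := hK 0
          simp only [dotProduct_zero, mul_zero, Real.exp_zero, mul_one] at this
          exact (norm_nonneg _).trans this
        exact mul_le_mul_of_nonneg_left (mul_le_mul_of_nonneg_left hw (Real.exp_pos _).le) hK0'

/-- In particular on the unit cube of parameters (`⟨Φ,Δ_sΦ⟩ ≥ c‖Φ‖²` there, p02 `quadForm_interpForm_ge`).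
[cite: BalabanImbrieJaffe1988, §5.13 p.305] -/
theorem integrable_growth {Δ : Matrix α α ℝ} {c : ℝ} (hcΔ : ∀ v, c * (v ⬝ᵥ v) ≤ v ⬝ᵥ (Δ *ᵥ v))
    {s : I → ℝ} (hs : ∀ j, 0 ≤ s j ∧ s j ≤ 1) (f : α → ℝ)
    {G : (α → ℝ) → ℝ} (hGm : AEStronglyMeasurable G volume) {K₀ ε : ℝ} (hε : 2 * ε < c)
    (hK : ∀ φ, ‖G φ‖ ≤ K₀ * Real.exp (ε * (φ ⬝ᵥ φ))) :
    Integrable fun φ : α → ℝ => G φ * (weight (interpForm blk Δ s) φ * source f φ) :=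
  integrable_growth_of_lower (BIJ88DirichletForms305.quadForm_interpForm_ge blk hcΔ hs) f hGm hε hK

/-- **The first `s`-derivative under the integral for observables of Gaussian growth**: `Δ` positive definite with form
bounds `c‖v‖² ≤ ⟨v,Δv⟩ ≤ C‖v‖²`, `s ∈ [0,1]^I`, `t₀ ∈ [0,1]`, `G` measurable with `‖G Φ‖ ≤ K₀e^{ε‖Φ‖²}`, `2ε < c`.  Then
`D_iG e^{−½⟨Φ,Δ_{s[i↦t₀]}Φ⟩}e^{⟨ℱ,Φ⟩}` is integrable and
`d/dt|_{t₀} ∫ G dμ_{s[i↦t]} = −∫ D_i G dμ_{s[i↦t₀]}`, `D_i = Σ_{j≠i}s_j⟨□_iΦ,Δ□_jΦ⟩` — p13 g6 `hasDerivAt_integral_interp`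
transported along the precision shift `Δ ↦ Δ − 2ε1` (which leaves `D_i` and the interpolation unchanged).
[cite: BalabanImbrieJaffe1988, §5.13 p.305] -/
theorem hasDerivAt_integral_interp_growth {Δ : Matrix α α ℝ} (hΔ : Δ.PosDef) {c C : ℝ}
    (hcΔ : ∀ v, c * (v ⬝ᵥ v) ≤ v ⬝ᵥ (Δ *ᵥ v)) (hCΔ : ∀ v, v ⬝ᵥ (Δ *ᵥ v) ≤ C * (v ⬝ᵥ v))
    {s : I → ℝ} (hs : ∀ j, 0 ≤ s j ∧ s j ≤ 1) (i : I) {t₀ : ℝ} (ht₀ : 0 ≤ t₀ ∧ t₀ ≤ 1) (f : α → ℝ)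
    {G : (α → ℝ) → ℝ} (hGm : AEStronglyMeasurable G volume) {K₀ ε : ℝ} (hε : 2 * ε < c)
    (hK : ∀ φ, ‖G φ‖ ≤ K₀ * Real.exp (ε * (φ ⬝ᵥ φ))) :
    Integrable (fun φ : α → ℝ => (∑ j ∈ univ.erase i, s j * blockPair blk Δ φ i j) * G φ *
        (weight (interpForm blk Δ (update s i t₀)) φ * source f φ)) ∧
    HasDerivAt (fun u => ∫ φ : α → ℝ, G φ * (weight (interpForm blk Δ (update s i u)) φ * source f φ))
      (-(∫ φ : α → ℝ, (∑ j ∈ univ.erase i, s j * blockPair blk Δ φ i j) * G φ *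
        (weight (interpForm blk Δ (update s i t₀)) φ * source f φ))) t₀ := by
  have hΔs : Δ.IsSymm := isSymm_of_posDef hΔ
  set Δ' : Matrix α α ℝ := Δ - (2 * ε) • (1 : Matrix α α ℝ) with hΔ'
  have hb := formBounds_shift hcΔ hCΔ (2 * ε)
  have hΔ's : Δ'.IsSymm := by
    rw [Matrix.IsSymm, hΔ', Matrix.transpose_sub, Matrix.transpose_smul, Matrix.transpose_one, hΔs.eq]
  have hc' : 0 < c - 2 * ε := by linarith
  have hΔ'p : Δ'.PosDef := posDef_of_formBound hΔ's hc' hb.1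
  have hcont : Continuous fun φ : α → ℝ => Real.exp (-(ε * (φ ⬝ᵥ φ))) :=
    (continuous_const.mul (continuous_id.dotProduct continuous_id)).neg.rexp
  have hG'm : AEStronglyMeasurable (fun φ : α → ℝ => G φ * Real.exp (-(ε * (φ ⬝ᵥ φ)))) volume :=
    hGm.mul hcont.aestronglyMeasurable
  have hG'b : ∀ φ : α → ℝ, ‖G φ * Real.exp (-(ε * (φ ⬝ᵥ φ)))‖ ≤ K₀ := fun φ => by
    rw [norm_mul, Real.norm_of_nonneg (Real.exp_pos _).le]
    have h := mul_le_mul_of_nonneg_right (hK φ) (Real.exp_pos (-(ε * (φ ⬝ᵥ φ)))).le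
    rwa [mul_assoc, ← Real.exp_add, add_neg_cancel, Real.exp_zero, mul_one] at h
  -- p13 g6 for the shifted data
  have key := hasDerivAt_integral_interp blk hΔ'p hc' hb.1 hb.2 hs i ht₀ f hG'm hG'b
  -- the transport identities
  have hw : ∀ (u : ℝ) (φ : α → ℝ), G φ * Real.exp (-(ε * (φ ⬝ᵥ φ))) *
      (weight (interpForm blk Δ' (update s i u)) φ * source f φ)
        = G φ * (weight (interpForm blk Δ (update s i u)) φ * source f φ) := fun u φ => by
    rw [hΔ', interpForm_sub_smul_one, weight_sub_smul_one]
    have : Real.exp (-(ε * (φ ⬝ᵥ φ))) * Real.exp (2 * ε / 2 * (φ ⬝ᵥ φ)) = 1 := by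
      rw [← Real.exp_add]
      convert Real.exp_zero using 2
      ring
    calc G φ * Real.exp (-(ε * (φ ⬝ᵥ φ))) *
          (weight (interpForm blk Δ (update s i u)) φ * Real.exp (2 * ε / 2 * (φ ⬝ᵥ φ)) * source f φ)
        = G φ * (Real.exp (-(ε * (φ ⬝ᵥ φ))) * Real.exp (2 * ε / 2 * (φ ⬝ᵥ φ)))
            * (weight (interpForm blk Δ (update s i u)) φ * source f φ) := by ring
      _ = _ := by rw [this, mul_one]
  have hD : ∀ φ : α → ℝ, ∑ j ∈ univ.erase i, s j * blockPair blk Δ' φ i j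
      = ∑ j ∈ univ.erase i, s j * blockPair blk Δ φ i j := fun φ => by
    rw [hΔ']
    exact D_sub_smul_one blk Δ (2 * ε) s i φ
  have hwD : ∀ φ : α → ℝ, (∑ j ∈ univ.erase i, s j * blockPair blk Δ' φ i j) * (G φ * Real.exp (-(ε * (φ ⬝ᵥ φ)))) *
      (weight (interpForm blk Δ' (update s i t₀)) φ * source f φ)
        = (∑ j ∈ univ.erase i, s j * blockPair blk Δ φ i j) * G φ *
          (weight (interpForm blk Δ (update s i t₀)) φ * source f φ) := fun φ => by
    rw [hD φ, mul_assoc, hw t₀ φ, ← mul_assoc]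
  refine ⟨key.1.congr (Eventually.of_forall hwD), ?_⟩
  have h2 := key.2
  simp_rw [hw] at h2
  refine h2.congr_deriv ?_
  congr 1
  exact integral_congr_ae (Eventually.of_forall hwD)

/-! ## §3  The quadratic insertions have Gaussian growth; the affine dependence of `D_i` on `s_j` -/

/-- **`|⟨□_iΦ,Δ□_jΦ⟩| ≤ (|C−c|/2)‖Φ‖²`** for `i ≠ j` (the vertex is `D_i` at the corner `s = e_j`; p13 g6 `abs_D_le`).
[cite: BalabanImbrieJaffe1988, §5.13 p.305] -/
theorem abs_blockPair_le {Δ : Matrix α α ℝ} (hΔ : Δ.IsSymm) {c C : ℝ} (hcΔ : ∀ v, c * (v ⬝ᵥ v) ≤ v ⬝ᵥ (Δ *ᵥ v))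
    (hCΔ : ∀ v, v ⬝ᵥ (Δ *ᵥ v) ≤ C * (v ⬝ᵥ v)) {i j : I} (hij : i ≠ j) (φ : α → ℝ) :
    |blockPair blk Δ φ i j| ≤ |C - c| / 2 * (φ ⬝ᵥ φ) := by
  have hs : ∀ l : I, 0 ≤ (Pi.single j (1:ℝ) : I → ℝ) l ∧ (Pi.single j (1:ℝ) : I → ℝ) l ≤ 1 := fun l => by
    by_cases h : l = j
    · subst h
      simp
    · simp [Pi.single_eq_of_ne h]
  have h := abs_D_le blk hΔ hcΔ hCΔ hs i φ
  have hsum : ∑ l ∈ univ.erase i, (Pi.single j (1:ℝ) : I → ℝ) l * blockPair blk Δ φ i l = blockPair blk Δ φ i j := by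
    rw [Finset.sum_eq_single j]
    · simp
    · intro l _ hl
      simp [Pi.single_eq_of_ne hl]
    · intro hj
      exact absurd (Finset.mem_erase.2 ⟨hij.symm, mem_univ j⟩) hj
  rwa [hsum] at h

omit [Fintype α] [DecidableEq α] [Fintype I] [DecidableEq I] in
/-- `x ≤ e^{εx}/ε` (`ε > 0`). [folklore] -/
private theorem le_exp_div {ε : ℝ} (hε : 0 < ε) (x : ℝ) : x ≤ Real.exp (ε * x) / ε := by
  rw [le_div_iff₀ hε]
  have := Real.add_one_le_exp (ε * x)
  nlinarith

omit [DecidableEq α] in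
/-- A quadratic-growth insertion times a bounded factor has Gaussian growth:
`|Q| ≤ K_Q‖Φ‖²` (`K_Q ≥ 0`), `‖H‖ ≤ K₀` ⇒ `‖Q·H‖ ≤ (K_QK₀/ε)e^{ε‖Φ‖²}` (`ε > 0`). [folklore] -/
private theorem growth_of_quad_mul_bdd {Q H : (α → ℝ) → ℝ} {KQ K₀ ε : ℝ} (hε : 0 < ε) (hKQ : 0 ≤ KQ)
    (hQ : ∀ φ, |Q φ| ≤ KQ * (φ ⬝ᵥ φ)) (hH : ∀ φ, ‖H φ‖ ≤ K₀) (φ : α → ℝ) :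
    ‖Q φ * H φ‖ ≤ KQ * K₀ / ε * Real.exp (ε * (φ ⬝ᵥ φ)) := by
  have hn : 0 ≤ φ ⬝ᵥ φ := Finset.sum_nonneg fun x _ => mul_self_nonneg (φ x)
  have hK0 : 0 ≤ K₀ := (norm_nonneg _).trans (hH φ)
  rw [norm_mul, Real.norm_eq_abs]
  have h2 : (φ ⬝ᵥ φ) ≤ Real.exp (ε * (φ ⬝ᵥ φ)) / ε := le_exp_div hε _
  calc |Q φ| * ‖H φ‖ ≤ KQ * (φ ⬝ᵥ φ) * K₀ := mul_le_mul (hQ φ) (hH φ) (norm_nonneg _) (mul_nonneg hKQ hn)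
    _ ≤ KQ * (Real.exp (ε * (φ ⬝ᵥ φ)) / ε) * K₀ := by gcongr
    _ = KQ * K₀ / ε * Real.exp (ε * (φ ⬝ᵥ φ)) := by ring

/-- *"hit factors s_j already pulled down"*: `D_i(s[j↦u]) = u·⟨□_iΦ,Δ□_jΦ⟩ + D_i(s[j↦0])` (`i ≠ j`) — the pulled-down
factor is affine in every other parameter (cf. p13 g6 `hasDerivAt_pulledFactor`). [cite: BalabanImbrieJaffe1988, §5.13 p.305] -/
theorem D_update_eq (Δ : Matrix α α ℝ) (s : I → ℝ) {i j : I} (hij : i ≠ j) (u : ℝ) (φ : α → ℝ) :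
    ∑ l ∈ univ.erase i, update s j u l * blockPair blk Δ φ i l
      = u * blockPair blk Δ φ i j + ∑ l ∈ univ.erase i, update s j 0 l * blockPair blk Δ φ i l := by
  have hmem : j ∈ univ.erase i := Finset.mem_erase.2 ⟨hij.symm, mem_univ j⟩
  rw [← Finset.add_sum_erase _ _ hmem, ← Finset.add_sum_erase _ (fun l => update s j 0 l * blockPair blk Δ φ i l) hmem,
    update_self, update_self, zero_mul, zero_add]
  congr 1
  exact Finset.sum_congr rfl fun l hl => by
    rw [update_of_ne (Finset.ne_of_mem_erase hl), update_of_ne (Finset.ne_of_mem_erase hl)]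

omit [Fintype I] in
/-- The vertex `Φ ↦ ⟨□_iΦ,Δ□_jΦ⟩` is continuous. [cite: BalabanImbrieJaffe1988, §5.13 p.305] -/
theorem continuous_blockPair (Δ : Matrix α α ℝ) (i j : I) : Continuous fun φ : α → ℝ => blockPair blk Δ φ i j := by
  show Continuous fun φ : α → ℝ => (boxProj blk i *ᵥ φ) ⬝ᵥ (Δ *ᵥ (boxProj blk j *ᵥ φ))
  exact (continuous_const.matrix_mulVec continuous_id).dotProduct
    (continuous_const.matrix_mulVec (continuous_const.matrix_mulVec continuous_id))

/-- `Φ ↦ D_i(Φ)` is continuous. [cite: BalabanImbrieJaffe1988, §5.13 p.305] -/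
theorem continuous_D (Δ : Matrix α α ℝ) (s : I → ℝ) (i : I) :
    Continuous fun φ : α → ℝ => ∑ l ∈ univ.erase i, s l * blockPair blk Δ φ i l :=
  continuous_finsetSum _ fun l _ => continuous_const.mul (continuous_blockPair blk Δ i l)

/-! ## §4  The numerator at second order -/

section SecondOrder

variable {Δ : Matrix α α ℝ} (hΔ : Δ.PosDef) {c C : ℝ} (hc : 0 < c)
  (hcΔ : ∀ v, c * (v ⬝ᵥ v) ≤ v ⬝ᵥ (Δ *ᵥ v)) (hCΔ : ∀ v, v ⬝ᵥ (Δ *ᵥ v) ≤ C * (v ⬝ᵥ v))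
  {s : I → ℝ} (hs : ∀ j, 0 ≤ s j ∧ s j ≤ 1) {i j : I} (hij : i ≠ j) (f : α → ℝ)
  {H : (α → ℝ) → ℝ} (hHm : AEStronglyMeasurable H volume) {K₀ : ℝ} (hK : ∀ φ, ‖H φ‖ ≤ K₀)

/-- `N_G(s′) = ∫ G e^{−½⟨Φ,Δ_{s′}Φ⟩}e^{⟨ℱ,Φ⟩}dΦ` — the unnormalized expectation. [cite: BalabanImbrieJaffe1988, §5.13 p.305] -/
def num (Δ : Matrix α α ℝ) (f : α → ℝ) (G : (α → ℝ) → ℝ) (s' : I → ℝ) : ℝ :=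
  ∫ φ : α → ℝ, G φ * (weight (interpForm blk Δ s') φ * source f φ)

/-- `D_i(s′, Φ) = Σ_{l≠i} s′_l⟨□_iΦ,Δ□_lΦ⟩` — the factor the first derivative pulls down. [cite: BalabanImbrieJaffe1988, §5.13 p.305] -/
def Dfun (Δ : Matrix α α ℝ) (s' : I → ℝ) (i : I) (φ : α → ℝ) : ℝ :=
  ∑ l ∈ univ.erase i, s' l * blockPair blk Δ φ i l

include hΔ hc hcΔ hCΔ hs hij hHm hK in
/-- **THE NUMERATOR AT SECOND ORDER** (`i ≠ j`): `∂/∂s_j|_{s} (−∫ D_i(s[j↦u]) H dμ_{s[j↦u]}) = ∫ (D_iD_j − ⟨□_iΦ,Δ□_jΦ⟩) H dμ_s`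
— the derivative `∂/∂s_j` either *hits the factor `s_j` already pulled down* in `D_i` (giving `−∫⟨□_iΦ,Δ□_jΦ⟩H`) or
*brings a new term down*, `D_j`, while `D_i` survives (giving `+∫D_iD_jH`). [cite: BalabanImbrieJaffe1988, §5.13 p.305] -/
theorem hasDerivAt_dnum :
    HasDerivAt (fun u => -num blk Δ f (fun φ => Dfun blk Δ (update s j u) i φ * H φ) (update s j u))
      (num blk Δ f (fun φ => (Dfun blk Δ s i φ * Dfun blk Δ s j φ - blockPair blk Δ φ i j) * H φ) s) (s j) := by
  have hΔs : Δ.IsSymm := isSymm_of_posDef hΔ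
  have hK0 : 0 ≤ K₀ := (norm_nonneg _).trans (hK 0)
  have hε : 2 * (c / 8) < c := by linarith
  have hε0 : 0 < c / 8 := by positivity
  have habs : 0 ≤ |C - c| / 2 := by positivity
  -- the two fixed insertions `B = ⟨□_iΦ,Δ□_jΦ⟩` and `D⁰ = D_i(s[j↦0])`, of Gaussian growth
  have hBm : AEStronglyMeasurable (fun φ : α → ℝ => blockPair blk Δ φ i j * H φ) volume :=
    (continuous_blockPair blk Δ i j).aestronglyMeasurable.mul hHm
  have hD0m : AEStronglyMeasurable (fun φ : α → ℝ => Dfun blk Δ (update s j 0) i φ * H φ) volume :=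
    (continuous_D blk Δ (update s j 0) i).aestronglyMeasurable.mul hHm
  have hBg : ∀ φ : α → ℝ, ‖blockPair blk Δ φ i j * H φ‖ ≤ |C - c| / 2 * K₀ / (c / 8) * Real.exp (c / 8 * (φ ⬝ᵥ φ)) :=
    growth_of_quad_mul_bdd hε0 habs (abs_blockPair_le blk hΔs hcΔ hCΔ hij) hK
  have hs0 : ∀ l, 0 ≤ update s j 0 l ∧ update s j 0 l ≤ 1 := update_mem_cube hs j ⟨le_refl _, zero_le_one⟩
  have hD0g : ∀ φ : α → ℝ, ‖Dfun blk Δ (update s j 0) i φ * H φ‖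
      ≤ |C - c| / 2 * K₀ / (c / 8) * Real.exp (c / 8 * (φ ⬝ᵥ φ)) :=
    growth_of_quad_mul_bdd hε0 habs (fun φ => abs_D_le blk hΔs hcΔ hCΔ hs0 i φ) hK
  have hsj : 0 ≤ s j ∧ s j ≤ 1 := hs j
  -- their first derivatives along `s_j` (§2)
  have hP := hasDerivAt_integral_interp_growth blk hΔ hcΔ hCΔ hs j hsj f hBm hε hBg
  have hQ := hasDerivAt_integral_interp_growth blk hΔ hcΔ hCΔ hs j hsj f hD0m hε hD0g
  rw [update_eq_self] at hP hQ
  -- near `u₀ = s j` the function splits as `−(u·P(u) + Q(u))` (linearity needs integrability, available where the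
  -- interpolated precision stays coercive: `quadForm_interp_ge_near`)
  have hr : 0 < c / (2 * |C - c| + c) := by positivity
  have hsplit : ∀ᶠ u in 𝓝 (s j),
      -num blk Δ f (fun φ => Dfun blk Δ (update s j u) i φ * H φ) (update s j u)
        = -(u * num blk Δ f (fun φ => blockPair blk Δ φ i j * H φ) (update s j u)
            + num blk Δ f (fun φ => Dfun blk Δ (update s j 0) i φ * H φ) (update s j u)) := by
    filter_upwards [Metric.ball_mem_nhds (s j) hr] with u hu
    have hu' : |u - s j| ≤ c / (2 * |C - c| + c) := by
      rw [Metric.mem_ball, Real.dist_eq] at hu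
      exact hu.le
    have hlow : ∀ φ : α → ℝ, c / 2 * (φ ⬝ᵥ φ) ≤ φ ⬝ᵥ (interpForm blk Δ (update s j u) *ᵥ φ) :=
      BIJ88SDerivative305.quadForm_interp_ge_near blk hc hcΔ hCΔ hs j hsj hu'
    have hε' : 2 * (c / 8) < c / 2 := by linarith
    have iB := integrable_growth_of_lower hlow f hBm hε' hBg
    have iD := integrable_growth_of_lower hlow f hD0m hε' hD0g
    rw [num, num, num, ← integral_const_mul, ← integral_add (iB.const_mul u) iD]
    congr 2
    funext φ
    simp only [Dfun]
    rw [D_update_eq blk Δ s hij u φ]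
    ring
  refine HasDerivAt.congr_of_eventuallyEq ?_ hsplit
  have hprod := ((hasDerivAt_id (s j)).mul hP.2).add hQ.2
  refine (hprod.neg).congr_deriv ?_
  -- evaluate: `−(P + u₀P′ + Q′) = ∫(D_iD_j − B)H` with `D_i = u₀B + D⁰`
  have iBD := hP.1
  have iDD := hQ.1
  have iB := integrable_growth blk hcΔ hs f hBm hε hBg
  have e : (∫ φ : α → ℝ, (Dfun blk Δ s i φ * Dfun blk Δ s j φ - blockPair blk Δ φ i j) * H φ *
        (weight (interpForm blk Δ s) φ * source f φ))
      = s j * (∫ φ : α → ℝ, (∑ l ∈ univ.erase j, s l * blockPair blk Δ φ j l) * (blockPair blk Δ φ i j * H φ) *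
          (weight (interpForm blk Δ s) φ * source f φ))
        + (∫ φ : α → ℝ, (∑ l ∈ univ.erase j, s l * blockPair blk Δ φ j l) * (Dfun blk Δ (update s j 0) i φ * H φ) *
          (weight (interpForm blk Δ s) φ * source f φ))
        - ∫ φ : α → ℝ, blockPair blk Δ φ i j * H φ * (weight (interpForm blk Δ s) φ * source f φ) := by
    have step : (∫ φ : α → ℝ, (Dfun blk Δ s i φ * Dfun blk Δ s j φ - blockPair blk Δ φ i j) * H φ *
          (weight (interpForm blk Δ s) φ * source f φ))
        = ∫ φ : α → ℝ, (s j * ((∑ l ∈ univ.erase j, s l * blockPair blk Δ φ j l) * (blockPair blk Δ φ i j * H φ) *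
              (weight (interpForm blk Δ s) φ * source f φ))
            + (∑ l ∈ univ.erase j, s l * blockPair blk Δ φ j l) * (Dfun blk Δ (update s j 0) i φ * H φ) *
              (weight (interpForm blk Δ s) φ * source f φ))
          - blockPair blk Δ φ i j * H φ * (weight (interpForm blk Δ s) φ * source f φ) := by
      refine integral_congr_ae (Eventually.of_forall fun φ => ?_)
      have hD : Dfun blk Δ s i φ = s j * blockPair blk Δ φ i j + Dfun blk Δ (update s j 0) i φ := by
        have := D_update_eq blk Δ s hij (s j) φ
        rw [update_eq_self] at this
        exact this
      beta_reduce
      rw [hD]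
      simp only [Dfun]
      ring
    rw [step, integral_sub ?_ iB, integral_add ?_ iDD, integral_const_mul]
    · exact iBD.const_mul _
    · exact (iBD.const_mul _).add iDD
  simp only [update_eq_self, id, one_mul]
  rw [num, e]
  ring

/-! ## §5  The normalized expectation at second order -/

include hΔ hc hcΔ hCΔ in
/-- p13 g6 `hasDerivAt_expectation_interp` in the present notation: `∂/∂s_i ⟨H⟩_{s′} = −(N_{D_iH}/N_1 − (N_{D_i}/N_1)(N_H/N_1))`
at every `s′ = s[j↦u]` of the cube. [cite: BalabanImbrieJaffe1988, §5.13 p.305] -/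
theorem hasDerivAt_expect {H : (α → ℝ) → ℝ} (hHm : AEStronglyMeasurable H volume) {K₀ : ℝ} (hK : ∀ φ, ‖H φ‖ ≤ K₀)
    (i : I) {s' : I → ℝ} (hs' : ∀ l, 0 ≤ s' l ∧ s' l ≤ 1) :
    HasDerivAt (fun t => BIJ88PairingDisplay305.expect blk Δ f H (update s' i t))
      (-(num blk Δ f (fun φ => Dfun blk Δ s' i φ * H φ) s' / num blk Δ f (fun _ => 1) s'
        - num blk Δ f (Dfun blk Δ s' i) s' / num blk Δ f (fun _ => 1) s'
          * (num blk Δ f H s' / num blk Δ f (fun _ => 1) s'))) (s' i) := by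
  have h := BIJ88SDerivative305.hasDerivAt_expectation_interp blk hΔ hc hcΔ hCΔ hs' i (hs' i) f hHm hK
  rw [update_eq_self] at h
  simp only [BIJ88PairingDisplay305.expect, num, Dfun, one_mul] at h ⊢
  exact h

include hΔ hc hcΔ hCΔ hs hij hHm hK in
/-- **THE NORMALIZED EXPECTATION AT SECOND ORDER** (`i ≠ j`, `s ∈ [0,1]^I`, `H` bounded measurable).  Writing
`⟨X⟩ = N_X(s)/N_1(s)`, `D_i = Σ_{l≠i}s_l⟨□_iΦ,Δ□_lΦ⟩`, `B = ⟨□_iΦ,Δ□_jΦ⟩`: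
`∂/∂s_j|_s [∂/∂s_i⟨H⟩](s[j↦u]) = −(⟨BH⟩ − ⟨B⟩⟨H⟩) + (⟨D_iD_jH⟩ − ⟨D_i⟩⟨D_jH⟩ − ⟨D_j⟩⟨D_iH⟩ − ⟨D_iD_j⟩⟨H⟩ + 2⟨D_i⟩⟨D_j⟩⟨H⟩)`,
i.e. `∂_j∂_i⟨H⟩_s = −⟨[B;]H⟩_s + κ₃(D_i,D_j,H)_s` — in print's signs `⟨[V_{ij};]H⟩_s + ⟨[D_i;][D_j;]H⟩_s`: the pairing
term AND the third truncation.  The function differentiated is `∂/∂s_i⟨H⟩` by `hasDerivAt_expect`.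
[cite: BalabanImbrieJaffe1988, §5.13 p.305] -/
theorem hasDerivAt_dexpect :
    HasDerivAt
      (fun u => -(num blk Δ f (fun φ => Dfun blk Δ (update s j u) i φ * H φ) (update s j u)
            / num blk Δ f (fun _ => 1) (update s j u)
          - num blk Δ f (Dfun blk Δ (update s j u) i) (update s j u) / num blk Δ f (fun _ => 1) (update s j u)
            * (num blk Δ f H (update s j u) / num blk Δ f (fun _ => 1) (update s j u))))
      (-(num blk Δ f (fun φ => blockPair blk Δ φ i j * H φ) s / num blk Δ f (fun _ => 1) s
          - num blk Δ f (fun φ => blockPair blk Δ φ i j) s / num blk Δ f (fun _ => 1) s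
            * (num blk Δ f H s / num blk Δ f (fun _ => 1) s))
        + (num blk Δ f (fun φ => Dfun blk Δ s i φ * Dfun blk Δ s j φ * H φ) s / num blk Δ f (fun _ => 1) s
          - num blk Δ f (Dfun blk Δ s i) s / num blk Δ f (fun _ => 1) s
            * (num blk Δ f (fun φ => Dfun blk Δ s j φ * H φ) s / num blk Δ f (fun _ => 1) s)
          - num blk Δ f (Dfun blk Δ s j) s / num blk Δ f (fun _ => 1) s
            * (num blk Δ f (fun φ => Dfun blk Δ s i φ * H φ) s / num blk Δ f (fun _ => 1) s)
          - num blk Δ f (fun φ => Dfun blk Δ s i φ * Dfun blk Δ s j φ) s / num blk Δ f (fun _ => 1) s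
            * (num blk Δ f H s / num blk Δ f (fun _ => 1) s)
          + 2 * (num blk Δ f (Dfun blk Δ s i) s / num blk Δ f (fun _ => 1) s)
            * (num blk Δ f (Dfun blk Δ s j) s / num blk Δ f (fun _ => 1) s)
            * (num blk Δ f H s / num blk Δ f (fun _ => 1) s)))
      (s j) := by
  have hΔs : Δ.IsSymm := isSymm_of_posDef hΔ
  have hsj : 0 ≤ s j ∧ s j ≤ 1 := hs j
  have hε : 2 * (c / 8) < c := by linarith
  have hε0 : 0 < c / 8 := by positivity
  have habs : 0 ≤ |C - c| / 2 := by positivity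
  -- §4 twice (with `H` and with `1`), and p13 g6 for `N_H`, `N_1`
  have hA := hasDerivAt_dnum blk hΔ hc hcΔ hCΔ hs hij f hHm hK
  have hA₁ := hasDerivAt_dnum blk hΔ hc hcΔ hCΔ hs hij f (H := fun _ => (1:ℝ)) aestronglyMeasurable_const
    (K₀ := 1) (fun _ => by simp)
  have hN := (hasDerivAt_integral_interp blk hΔ hc hcΔ hCΔ hs j hsj f hHm hK).2
  have hZ := (hasDerivAt_integral_interp blk hΔ hc hcΔ hCΔ hs j hsj f (G := fun _ => (1:ℝ))
    aestronglyMeasurable_const (K₀ := 1) (fun _ => by simp)).2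
  rw [update_eq_self] at hN hZ
  have hZ0 : num blk Δ f (fun _ => (1:ℝ)) s ≠ 0 := by
    have := integral_weight_mul_source_pos (interpForm_posDef blk hΔ hs) f
    simp only [num, one_mul]
    exact this.ne'
  -- the function of `u`, rewritten through `N`'s
  have hfun : (fun u => -(num blk Δ f (fun φ => Dfun blk Δ (update s j u) i φ * H φ) (update s j u)
            / num blk Δ f (fun _ => 1) (update s j u)
          - num blk Δ f (Dfun blk Δ (update s j u) i) (update s j u) / num blk Δ f (fun _ => 1) (update s j u)
            * (num blk Δ f H (update s j u) / num blk Δ f (fun _ => 1) (update s j u))))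
      = fun u => (-num blk Δ f (fun φ => Dfun blk Δ (update s j u) i φ * H φ) (update s j u))
            / num blk Δ f (fun _ => 1) (update s j u)
          - (-num blk Δ f (fun φ => Dfun blk Δ (update s j u) i φ * (1:ℝ)) (update s j u))
            / num blk Δ f (fun _ => 1) (update s j u)
            * (num blk Δ f H (update s j u) / num blk Δ f (fun _ => 1) (update s j u)) := by
    funext u
    simp only [mul_one]
    ring
  rw [hfun]
  have hN' : HasDerivAt (fun u => num blk Δ f H (update s j u))
      (-(num blk Δ f (fun φ => Dfun blk Δ s j φ * H φ) s)) (s j) := by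
    simp only [num, Dfun]
    exact hN
  have hZ' : HasDerivAt (fun u => num blk Δ f (fun _ => (1:ℝ)) (update s j u))
      (-(num blk Δ f (Dfun blk Δ s j) s)) (s j) := by
    simp only [num, Dfun, one_mul, mul_one] at hZ ⊢
    exact hZ
  have hZ0' : num blk Δ f (fun _ => (1:ℝ)) (update s j (s j)) ≠ 0 := by
    rw [update_eq_self]
    exact hZ0
  have key := ((hA.div hZ' hZ0').sub ((hA₁.div hZ' hZ0').mul (hN'.div hZ' hZ0')))
  refine key.congr_deriv ?_
  simp only [update_eq_self, mul_one, Pi.div_apply]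
  have e1 : num blk Δ f (fun φ => (Dfun blk Δ s i φ * Dfun blk Δ s j φ - blockPair blk Δ φ i j) * H φ) s
      = num blk Δ f (fun φ => Dfun blk Δ s i φ * Dfun blk Δ s j φ * H φ) s
        - num blk Δ f (fun φ => blockPair blk Δ φ i j * H φ) s := by
    have hK0 : 0 ≤ K₀ := (norm_nonneg _).trans (hK 0)
    have hBm : AEStronglyMeasurable (fun φ : α → ℝ => blockPair blk Δ φ i j * H φ) volume :=
      (continuous_blockPair blk Δ i j).aestronglyMeasurable.mul hHm
    have hBg : ∀ φ : α → ℝ, ‖blockPair blk Δ φ i j * H φ‖ ≤ |C - c| / 2 * K₀ / (c / 8) * Real.exp (c / 8 * (φ ⬝ᵥ φ)) :=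
      growth_of_quad_mul_bdd hε0 habs (abs_blockPair_le blk hΔs hcΔ hCΔ hij) hK
    have iB := integrable_growth blk hcΔ hs f hBm hε hBg
    have hDm : AEStronglyMeasurable (fun φ : α → ℝ => Dfun blk Δ s i φ * H φ) volume :=
      (continuous_D blk Δ s i).aestronglyMeasurable.mul hHm
    have hDg : ∀ φ : α → ℝ, ‖Dfun blk Δ s i φ * H φ‖ ≤ |C - c| / 2 * K₀ / (c / 8) * Real.exp (c / 8 * (φ ⬝ᵥ φ)) :=
      growth_of_quad_mul_bdd hε0 habs (fun φ => abs_D_le blk hΔs hcΔ hCΔ hs i φ) hK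
    have iDD := (hasDerivAt_integral_interp_growth blk hΔ hcΔ hCΔ hs j hsj f hDm hε hDg).1
    rw [update_eq_self] at iDD
    rw [num, num, num, ← integral_sub ?_ iB]
    · congr 1
      funext φ
      simp only [Dfun]
      ring
    · refine iDD.congr (Eventually.of_forall fun φ => ?_)
      simp only [Dfun]
      ring
  have e2 : num blk Δ f (fun φ => Dfun blk Δ s i φ * Dfun blk Δ s j φ - blockPair blk Δ φ i j) s
      = num blk Δ f (fun φ => Dfun blk Δ s i φ * Dfun blk Δ s j φ) s
        - num blk Δ f (fun φ => blockPair blk Δ φ i j) s := by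
    have hBm : AEStronglyMeasurable (fun φ : α → ℝ => blockPair blk Δ φ i j * (1:ℝ)) volume :=
      (continuous_blockPair blk Δ i j).aestronglyMeasurable.mul aestronglyMeasurable_const
    have hBg : ∀ φ : α → ℝ, ‖blockPair blk Δ φ i j * (1:ℝ)‖ ≤ |C - c| / 2 * 1 / (c / 8) * Real.exp (c / 8 * (φ ⬝ᵥ φ)) :=
      growth_of_quad_mul_bdd hε0 habs (abs_blockPair_le blk hΔs hcΔ hCΔ hij) (fun _ => by simp)
    have iB := integrable_growth blk hcΔ hs f hBm hε hBg
    have hDm : AEStronglyMeasurable (fun φ : α → ℝ => Dfun blk Δ s i φ * (1:ℝ)) volume :=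
      (continuous_D blk Δ s i).aestronglyMeasurable.mul aestronglyMeasurable_const
    have hDg : ∀ φ : α → ℝ, ‖Dfun blk Δ s i φ * (1:ℝ)‖ ≤ |C - c| / 2 * 1 / (c / 8) * Real.exp (c / 8 * (φ ⬝ᵥ φ)) :=
      growth_of_quad_mul_bdd hε0 habs (fun φ => abs_D_le blk hΔs hcΔ hCΔ hs i φ) (fun _ => by simp)
    have iDD := (hasDerivAt_integral_interp_growth blk hΔ hcΔ hCΔ hs j hsj f hDm hε hDg).1
    rw [update_eq_self] at iDD
    rw [num, num, num, ← integral_sub ?_ (iB.congr (Eventually.of_forall fun φ => by simp))]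
    · congr 1
      funext φ
      simp only [Dfun]
      ring
    · refine iDD.congr (Eventually.of_forall fun φ => ?_)
      simp only [Dfun]
      ring
  rw [e1, e2]
  field_simp
  ring

end SecondOrder

end Literature.MathematicalPhysics.QuantumFieldTheory.BalabanImbrieJaffe1984to88.BIJ88SecondOrder5133
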